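import Literature.NumberTheory.Automorphic.MirabolicEisensteinMajorant
import Literature.NumberTheory.Automorphic.AdelicPiSchwartzBruhatFourier
import Literature.NumberTheory.Automorphic.IdeleNormOneSplitting
import HarnessLib

/-!
# Decay of lattice sums of a Schwartz–Bruhat function at idelic scale:
# `Σ_{v ∈ Kⁿ ∖ 0} |Φ(y v)| ≤ B |y|_𝔸^{-θ/[K:ℚ]}`
(Gelbart, *Automorphic forms on adele groups* (1975), Lemma 9.13 and (9.45)–(9.46):
`Σ_{ξ ≠ 0} |f̂(ξ, μ, v h_t k)| ≤ C_N e^{2t} e^{-2Nt}`, the decay of the dual lattice sum after Poisson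
summation in the cusp; Godement–Jacquet, LNM 260, Lemma 11.5–11.6 for the Epstein-type sums)

Topic `NumberTheory/Automorphic`; theorems only. For a factorizable Schwartz–Bruhat function `Φ` on
`𝔸_Kⁿ` (`IsFactorizablePiSchwartzBruhat`, `AdelicPiSchwartzBruhatFourier` — the class stable under
the adelic Fourier transform) and `θ > n [K:ℚ]`:

* `IsFactorizablePiSchwartzBruhat.exists_decay_data` — archimedean decay of every order,
  `‖Φ(x)‖ ≤ M (1 + ‖x_∞‖)^{-k}`, and vanishing unless `x_f` lies in a fixed compact set (Schwartz
  decay of the archimedean factor, boundedness and compact support of the finite factor);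
* `tsum_ratVec_smul_ne_zero_eq` — `Σ_{v ≠ 0} F(k v) = Σ_{v ≠ 0} F(v)` for `k ∈ Kˣ`;
* `exists_tsum_enorm_smul_ratVec_le_rpow` — **main**: there is `B < ∞` with
  `Σ_{v ∈ Kⁿ ∖ 0} ‖Φ(y • v)‖ₑ ≤ B · |y|_𝔸^{-θ/[K:ℚ]}` for EVERY idele `y` (the dyadic covering
  `𝕀_K = Kˣ · ⋃_r Y_r` of `IdelicDyadicUnfolding` reduces to `y ∈ Y_r` with `|y| ≍ r^{[K:ℚ]}`, where
  `MirabolicEisensteinMajorant.exists_tsum_enorm_smul_le_of_decay` bounds the sum by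
  `M (c r)^{-θ} · T_θ`, `T_θ < ∞` by `tsum_norm_vecInfinitePart_rpow_neg_lt_top`).

For `n = 1` and `y = λ⁻¹` this is the bound `Σ_{ξ ≠ 0} |φ̂(ξ λ⁻¹)| ≤ B |λ|^{θ/[K:ℚ]}` used for the
`J`-part of the parabolic term of the `GL₂` trace formula (inline (D-0026) decomposition of
`Literature.NumberTheory.Automorphic.jacquetLanglands_transfer_exists`, with `AdelicPoissonScaled`).

## References

* S. Gelbart, *Automorphic forms on adele groups*, Ann. of Math. Studies 83 (1975), Lemma 9.13,
  (9.45)–(9.46) [Gelbart1975].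
* R. Godement, H. Jacquet, *Zeta functions of simple algebras*, LNM 260 (1972), §11
  [GodementJacquetLNM260].
-/

noncomputable section

open scoped NNReal ENNReal Classical
open NumberField NumberField.mixedEmbedding IsDedekindDomain Set

namespace Literature.NumberTheory.Automorphic

open Literature.NumberTheory.GaloisRepresentations (ideleGroup)

variable (K : Type) [Field K] [NumberField K] {n : ℕ}

local notation "𝔸K" => AdeleRing (𝓞 K) K
local notation "𝕀K" => (AdeleRing (𝓞 K) K)ˣ

/-! ### Decay data of a factorizable Schwartz–Bruhat function -/

/-- **Decay data.** A factorizable Schwartz–Bruhat function `Φ = Φ_∞ ⊗ Φ_f` on `𝔸_Kⁿ` decays like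
`(1 + ‖x_∞‖)^{-k}` for every `k` and vanishes unless `x_f` lies in the compact support of `Φ_f`.
[folklore] -/
theorem IsFactorizablePiSchwartzBruhat.exists_decay_data {Φ : (Fin n → 𝔸K) → ℂ}
    (hΦ : IsFactorizablePiSchwartzBruhat K (Fin n) Φ) (k : ℕ) :
    ∃ M : ℝ, 0 ≤ M ∧ (∀ x, ‖Φ x‖ ≤ M * (1 + ‖vecInfinitePart K n x‖) ^ (-(k : ℝ))) ∧
      ∃ Cf : Set (Fin n → FiniteAdeleRing (𝓞 K) K), IsCompact Cf ∧
        ∀ x, vecFinitePart K n x ∉ Cf → Φ x = 0 := by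
  obtain ⟨Φinf, Φfin, hfin, rfl⟩ := hΦ
  obtain ⟨hlc, hcs⟩ := (mem_schwartzBruhat_iff).1 hfin
  obtain ⟨C, hC⟩ := hcs.exists_bound_of_continuous hlc.continuous
  have hC0 : 0 ≤ C := (norm_nonneg _).trans (hC 0)
  set S : ℝ := 2 ^ k * (Finset.Iic (k, 0)).sup (fun m => SchwartzMap.seminorm ℝ m.1 m.2) Φinf with hS
  have hS0 : 0 ≤ S := by positivity
  refine ⟨S * C, mul_nonneg hS0 hC0, fun x => ?_, tsupport Φfin, hcs.isCompact, fun x hx => ?_⟩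
  · rw [norm_mul]
    have h1 : ‖Φinf (piArch K (Fin n) x)‖ ≤ S * (1 + ‖vecInfinitePart K n x‖) ^ (-(k : ℝ)) :=
      SchwartzMap.norm_le_mul_one_add_norm_rpow_neg Φinf k _
    calc ‖Φinf (piArch K (Fin n) x)‖ * ‖Φfin (piFinite K (Fin n) x)‖
        ≤ (S * (1 + ‖vecInfinitePart K n x‖) ^ (-(k : ℝ))) * C :=
          mul_le_mul h1 (hC _) (norm_nonneg _) (by positivity)
      _ = S * C * (1 + ‖vecInfinitePart K n x‖) ^ (-(k : ℝ)) := by ring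
  · have : Φfin (piFinite K (Fin n) x) = 0 := image_eq_zero_of_notMem_tsupport hx
    change Φinf (piArch K (Fin n) x) * Φfin (piFinite K (Fin n) x) = 0
    rw [this, mul_zero]

/-! ### Reindexing the non-zero rational vectors by a scalar -/

/-- `v ↦ k • v` permutes `Kⁿ ∖ 0` (`k ∈ Kˣ`). [folklore] -/
theorem tsum_ratVec_smul_ne_zero_eq (k : Kˣ) (F : (Fin n → 𝔸K) → ℝ≥0∞) :
    ∑' v : ↥{v : Fin n → K | v ≠ 0}, F (ratVec K ((k : K) • v.1)) =
      ∑' v : ↥{v : Fin n → K | v ≠ 0}, F (ratVec K v.1) := by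
  set e : ↥{v : Fin n → K | v ≠ 0} ≃ ↥{v : Fin n → K | v ≠ 0} :=
    { toFun := fun v => ⟨(k : K) • v.1, smul_ne_zero (Units.ne_zero k) v.2⟩
      invFun := fun v => ⟨((k⁻¹ : Kˣ) : K) • v.1, smul_ne_zero (Units.ne_zero k⁻¹) v.2⟩
      left_inv := fun v => Subtype.ext (by simp [smul_smul])
      right_inv := fun v => Subtype.ext (by simp [smul_smul]) } with he
  exact e.tsum_eq fun v => F (ratVec K v.1)

/-- `ι(k) • (ξᵢ) = (k ξᵢ)` for a principal idele. [folklore] -/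
theorem principalIdele_smul_ratVec (k : Kˣ) (v : Fin n → K) :
    ((principalIdele K k : 𝕀K) : 𝔸K) • ratVec K v = ratVec K ((k : K) • v) := by
  funext i
  simp only [Pi.smul_apply, smul_eq_mul, ratVec, map_mul]
  rfl

/-! ### The decay of lattice sums at idelic scale -/

/-- **`Σ_{v ∈ Kⁿ ∖ 0} ‖Φ(y • v)‖ ≤ B |y|_𝔸^{-θ/[K:ℚ]}` for every idele `y`**, for a factorizable
Schwartz–Bruhat function `Φ` on `𝔸_Kⁿ` and `θ > n [K:ℚ]`, with `B < ∞` depending only on `Φ`, `θ`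
(Gelbart (1975), (9.45)–(9.46): the decay in the cusp of the dual lattice sum; Godement–Jacquet,
Lemma 11.5–11.6). [cite: Gelbart1975, (9.45)–(9.46)] -/
theorem exists_tsum_enorm_smul_ratVec_le_rpow {Φ : (Fin n → 𝔸K) → ℂ}
    (hΦ : IsFactorizablePiSchwartzBruhat K (Fin n) Φ) {θ : ℝ}
    (hθ : (n : ℝ) * Module.finrank ℚ K < θ) :
    ∃ B : ℝ≥0∞, B ≠ ∞ ∧ ∀ y : 𝕀K,
      ∑' v : ↥{v : Fin n → K | v ≠ 0}, ‖Φ ((y : 𝔸K) • ratVec K v.1)‖ₑ ≤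
        B * ENNReal.ofReal ((IdeleClassGroup.ideleNorm K y : ℝ) ^ (-θ / Module.finrank ℚ K)) := by
  have hd : (0 : ℝ) < Module.finrank ℚ K := Nat.cast_pos.2 Module.finrank_pos
  have hθ0 : 0 ≤ θ := le_trans (by positivity) hθ.le
  -- decay data of order `k ≥ θ` and the majorant
  set k : ℕ := ⌈θ⌉₊ with hk
  have hθk : θ ≤ k := Nat.le_ceil θ
  obtain ⟨M, hM0, hM, Cf, hCfc, hCf⟩ := hΦ.exists_decay_data K k
  obtain ⟨c, C, hc, hCc, hbound⟩ := exists_tsum_enorm_smul_le_of_decay K (1 : GL (Fin n) 𝔸K)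
    hM0 hM hCfc hCf
  set T : ℝ≥0∞ := ∑' v : ↥{v : Fin n → K | v ≠ 0 ∧
      vecFinitePart K n (Matrix.vecMul (ratVec K v) ((1 : GL (Fin n) 𝔸K) : Matrix (Fin n) (Fin n) 𝔸K)) ∈ C},
    ENNReal.ofReal (‖vecInfinitePart K n (Matrix.vecMul (ratVec K (v : Fin n → K))
      ((1 : GL (Fin n) 𝔸K) : Matrix (Fin n) (Fin n) 𝔸K))‖ ^ (-θ)) with hT
  have hTfin : T < ⊤ := tsum_norm_vecInfinitePart_rpow_neg_lt_top K 1 hCc hθ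
  refine ⟨ENNReal.ofReal (M * c ^ (-θ)) * T, ENNReal.mul_ne_top ENNReal.ofReal_ne_top hTfin.ne,
    fun y => ?_⟩
  -- put `y` into a dyadic set: `y = ι(k₀) y'`, `y' ∈ Y_r`, `r^d = |y|`
  set N : ℝ := (IdeleClassGroup.ideleNorm K y : ℝ) with hN
  have hN0 : 0 < N := NNReal.coe_pos.2 (pos_iff_ne_zero.2 (ideleNorm_ne_zero y))
  set r : ℝ≥0ˣ := Units.mk0 ⟨N ^ ((Module.finrank ℚ K : ℝ)⁻¹), Real.rpow_nonneg hN0.le _⟩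
    (by
      intro h
      have := congrArg (fun t : ℝ≥0 => (t : ℝ)) h
      simp only [NNReal.coe_zero] at this
      exact (Real.rpow_pos_of_pos hN0 _).ne' this) with hr
  have hrN : ((r : ℝ≥0) : ℝ) ^ Module.finrank ℚ K = N := by
    change (N ^ ((Module.finrank ℚ K : ℝ)⁻¹)) ^ Module.finrank ℚ K = N
    rw [← Real.rpow_natCast, ← Real.rpow_mul hN0.le, inv_mul_cancel₀ hd.ne', Real.rpow_one]
  obtain ⟨k₀, y', hy', hyy'⟩ := exists_principalIdele_mul_mem_dyadicIdeleSet K r (x := y)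
    (by rw [hrN]; linarith) (by rw [hrN]; linarith)
  -- reindex the sum by `v ↦ k₀ v`
  have hre : ∑' v : ↥{v : Fin n → K | v ≠ 0}, ‖Φ ((y : 𝔸K) • ratVec K v.1)‖ₑ =
      ∑' v : ↥{v : Fin n → K | v ≠ 0}, ‖Φ ((y' : 𝔸K) •
        (Matrix.vecMul (ratVec K v.1) ((1 : GL (Fin n) 𝔸K) : Matrix (Fin n) (Fin n) 𝔸K)))‖ₑ := by
    have h1 : ∀ v : ↥{v : Fin n → K | v ≠ 0}, (y : 𝔸K) • ratVec K v.1 =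
        (y' : 𝔸K) • ratVec K ((k₀ : K) • v.1) := by
      intro v
      rw [hyy', Units.val_mul, mul_comm, mul_smul, principalIdele_smul_ratVec]
    simp_rw [h1, Matrix.GeneralLinearGroup.coe_one, Matrix.vecMul_one]
    exact tsum_ratVec_smul_ne_zero_eq K k₀ fun w => ‖Φ ((y' : 𝔸K) • w)‖ₑ
  rw [hre]
  refine (hbound θ hθ0 hθk r y' hy').trans ?_
  -- `M (c r)^{-θ} T = (M c^{-θ}) T N^{-θ/d}`
  have hr0 : 0 < ((r : ℝ≥0) : ℝ) := NNReal.coe_pos.2 (pos_iff_ne_zero.2 r.ne_zero)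
  have hpow : (c * ((r : ℝ≥0) : ℝ)) ^ (-θ) = c ^ (-θ) * N ^ (-θ / Module.finrank ℚ K) := by
    rw [Real.mul_rpow hc.le hr0.le]
    congr 1
    change (N ^ ((Module.finrank ℚ K : ℝ)⁻¹)) ^ (-θ) = _
    rw [← Real.rpow_mul hN0.le, neg_div, div_eq_mul_inv, mul_comm θ]
    congr 1
    ring
  rw [hpow, ← mul_assoc M, ENNReal.ofReal_mul (by positivity), mul_assoc, mul_assoc,
    mul_comm (ENNReal.ofReal (N ^ _)) T]

end Literature.NumberTheory.Automorphic
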